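import Mathlib.Analysis.Calculus.Deriv.Slope
import Mathlib.Analysis.Calculus.Deriv.Prod
import Mathlib.Topology.Algebra.Module.FiniteDimension
import Literature.NumberTheory.Automorphic.ArchimedeanEnvelopingAction
import Literature.NumberTheory.Automorphic.ArchimedeanLieDerivKFinite
import Literature.NumberTheory.Automorphic.ArchFlowParametricIntegral
import HarnessLib

/-!
# Lie derivatives along `𝔨` stay in the `K`-span; `Z(𝔤)`-finiteness of Lie derivatives on the
two calculus facts (any linear real group)

Topic `NumberTheory/Automorphic`; archimedean calculus in the setting of `ArchimedeanCalculus`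
(`H : RealMatrixGroup A N`, `ι : H → G` a homomorphism into a group, functions `G → ℂ`), serving the
`𝔤`-stability of the space of automorphic forms (Borel–Jacquet 1979, 4.3; sibling file
`AutomorphicFormsStable`). Two groups of results, all proved:

* `exists_finset_forall_eval_eq_zero_imp`, `mem_of_hasDerivAt_apply` — a finite-dimensional space
  `E` of complex functions on any set is detected on finitely many points, and is therefore closed
  under pointwise differentiation of curves lying in it (on a finite set of points `T` the
  derivative is a limit of difference quotients in the closed finite-dimensional subspace
  `E|_T ≤ ℂ^T`); whence `IsArchSmooth.lieDeriv_mem_kTranslateSpan`: for `Y ∈ 𝔤` with `exp(tY) ∈ K`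
  for all `t`, the Lie derivative `Y φ` of a smooth `K`-finite `φ` lies in the span of the right
  `K`-translates of `φ` (Borel 1997, 2.16 with one factor in `𝔨`: `r_k X f = (ᵏX)(r_k f)`, so the
  `K`-span is `𝔨`-stable) — the input of the unconditional `𝔨`-part of Borel–Jacquet 4.3;
* `isZFinite_lieDeriv_of` — Lie derivatives of smooth `Z(𝔤)`-finite functions are `Z(𝔤)`-finite,
  for ANY `H`, granted the two calculus facts `isArchSmooth_lieDeriv` and `applyFree_congr` of
  `ArchimedeanCalculus` (through `IsArchSmooth.applyFree_of`, `applyFree_ι_mul_of`,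
  `applyFree_lieDeriv_of_isCentralWord_of`: `z (X φ) = X (z φ)` for central `z`). This is the
  argument of `ArchimedeanEnvelopingAction` (`isZFinite_lieDeriv_of_top`, stated there for
  `𝔤 = 𝔤𝔩(N, A)` where the two facts are theorems) with the facts as hypotheses, so that it applies
  to a general regular automorphy datum once they are discharged for it.

## References

* A. Borel, H. Jacquet, *Automorphic forms and automorphic representations*, Proc. Sympos. Pure
  Math. 33 (Corvallis 1977), Part 1 (1979), 189–202, §1.5–1.6 and 4.3 [BorelJacquetCorvallis1979].
* A. Borel, *Automorphic forms on `SL₂(ℝ)`*, Cambridge Tracts in Math. 130 (1997), 2.16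
  [Borel1997].
-/

noncomputable section

open scoped MatrixGroups Matrix ContDiff Topology
open Filter

namespace Literature.NumberTheory.Automorphic

/-! ### Finite-dimensional function spaces are closed under differentiation of curves -/

section FunctionSpaces

variable {G : Type*}

/-- **A finite-dimensional space of functions is detected on finitely many points**: for a
finite-dimensional subspace `E` of `G → ℂ` there is a finite `S ⊆ G` such that an element of `E`
vanishing on `S` vanishes identically (induction on `dim E`: add a point where a non-zero element is
non-zero). [folklore] -/
theorem exists_finset_forall_eval_eq_zero_imp (E : Submodule ℂ (G → ℂ)) [FiniteDimensional ℂ E] :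
    ∃ S : Finset G, ∀ ψ ∈ E, (∀ s ∈ S, ψ s = 0) → ψ = 0 := by
  classical
  suffices h : ∀ (d : ℕ) (E : Submodule ℂ (G → ℂ)), FiniteDimensional ℂ E →
      Module.finrank ℂ E ≤ d → ∃ S : Finset G, ∀ ψ ∈ E, (∀ s ∈ S, ψ s = 0) → ψ = 0 from
    h _ E inferInstance le_rfl
  intro d
  induction d with
  | zero =>
    intro E _ hd
    refine ⟨∅, fun ψ hψ _ => ?_⟩
    have hE : E = ⊥ := Submodule.finrank_eq_zero.1 (Nat.le_zero.1 hd)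
    simpa [hE] using hψ
  | succ d ih =>
    intro E _ hd
    by_cases hE : ∀ ψ ∈ E, ψ = 0
    · exact ⟨∅, fun ψ hψ _ => hE ψ hψ⟩
    push Not at hE
    obtain ⟨ψ₀, hψ₀E, hψ₀⟩ := hE
    obtain ⟨g₀, hg₀⟩ : ∃ g₀, ψ₀ g₀ ≠ 0 := by
      by_contra h
      push Not at h
      exact hψ₀ (funext h)
    -- the functions of `E` vanishing at `g₀` form a subspace of smaller dimension
    set E' : Submodule ℂ (G → ℂ) :=
      E ⊓ LinearMap.ker (LinearMap.proj g₀ : (G → ℂ) →ₗ[ℂ] ℂ) with hE'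
    have hlt : E' < E := by
      refine lt_of_le_of_ne inf_le_left fun h => hg₀ ?_
      have hmem : ψ₀ ∈ E' := h ▸ hψ₀E
      exact LinearMap.mem_ker.1 (Submodule.mem_inf.1 hmem).2
    haveI : FiniteDimensional ℂ E' := Submodule.finiteDimensional_of_le inf_le_left
    have hd' : Module.finrank ℂ E' ≤ d :=
      Nat.lt_succ_iff.1 (lt_of_lt_of_le (Submodule.finrank_lt_finrank_of_lt hlt) hd)
    obtain ⟨S', hS'⟩ := ih E' inferInstance hd'
    refine ⟨insert g₀ S', fun ψ hψ hS => ?_⟩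
    have hψE' : ψ ∈ E' :=
      Submodule.mem_inf.2 ⟨hψ, LinearMap.mem_ker.2 (hS g₀ (Finset.mem_insert_self _ _))⟩
    exact hS' ψ hψE' fun s hs => hS s (Finset.mem_insert_of_mem hs)

/-- **Finite-dimensional function spaces are closed under pointwise differentiation of curves.**
If `E ≤ (G → ℂ)` is finite-dimensional, `γ : ℝ → E` (any curve with values in `E`) and
`t ↦ γ t g` has derivative `δ g` at `0` for every point `g`, then `δ ∈ E`: on each finite set of
points `T`, the restriction of `δ` is the limit of difference quotients in the closed
(finite-dimensional) subspace `E|_T ≤ ℂ^T`, hence agrees on `T` with an element of `E`, and finitely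
many points separate `E` (`exists_finset_forall_eval_eq_zero_imp`). (The mechanism behind "the
`K`-span of a `K`-finite vector is `𝔨`-stable", Borel 1997, 2.16.) [folklore] -/
theorem mem_of_hasDerivAt_apply {E : Submodule ℂ (G → ℂ)} [FiniteDimensional ℂ E]
    {γ : ℝ → G → ℂ} {δ : G → ℂ} (hγ : ∀ t, γ t ∈ E)
    (hδ : ∀ g, HasDerivAt (fun t => γ t g) (δ g) 0) : δ ∈ E := by
  classical
  -- on every finite set of points `δ` agrees with an element of `E`
  have key : ∀ T : Finset G, ∃ ψ ∈ E, ∀ s ∈ T, ψ s = δ s := by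
    intro T
    let ρ : (G → ℂ) →ₗ[ℂ] (T → ℂ) := LinearMap.funLeft ℂ ℂ ((↑) : T → G)
    set R : Submodule ℂ (T → ℂ) := E.map ρ with hR
    have hRc : IsClosed (R : Set (T → ℂ)) := R.closed_of_finiteDimensional
    have hc : HasDerivAt (fun t => ρ (γ t)) (ρ δ) 0 := hasDerivAt_pi.2 fun s => hδ s
    have hmem : ρ δ ∈ R := by
      rw [hasDerivAt_iff_tendsto_slope] at hc
      refine hRc.mem_of_tendsto hc (Eventually.of_forall fun t => ?_)
      rw [slope_def_module]
      exact R.smul_of_tower_mem _ (R.sub_mem (Submodule.mem_map_of_mem (hγ t))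
        (Submodule.mem_map_of_mem (hγ 0)))
    obtain ⟨ψ, hψ, hψδ⟩ := Submodule.mem_map.1 hmem
    exact ⟨ψ, hψ, fun s hs => congr_fun hψδ ⟨s, hs⟩⟩
  obtain ⟨S, hS⟩ := exists_finset_forall_eval_eq_zero_imp E
  obtain ⟨ψ, hψE, hψS⟩ := key S
  suffices h : δ = ψ by rw [h]; exact hψE
  funext g
  obtain ⟨ψ', hψ'E, hψ'S⟩ := key (insert g S)
  have h' : ψ' - ψ = 0 := hS _ (E.sub_mem hψ'E hψE) fun s hs => by
    rw [Pi.sub_apply, hψS s hs, hψ'S s (Finset.mem_insert_of_mem hs), sub_self]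
  have hg : ψ' g - ψ g = 0 := by simpa using congr_fun h' g
  rw [← hψ'S g (Finset.mem_insert_self _ _)]
  exact sub_eq_zero.1 hg

end FunctionSpaces

/-! ### Lie derivatives along `𝔨` stay in the `K`-span; `Z(𝔤)`-finiteness on the calculus facts -/

section ArchCalculus

variable {A : Type*} [NormedCommRing A] [NormedAlgebra ℝ A] [NormedAlgebra ℚ A] [CompleteSpace A]
  [StarRing A] {N : Type*} [Fintype N] [DecidableEq N] {H : RealMatrixGroup A N}
  {G : Type*} [Group G] {ι : H.carrier →* G}

/-- **Lie derivatives along directions exponentiating into `K` stay in the `K`-span** (Borel 1997,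
2.16 with one factor, in `𝔨`): if `φ` is smooth in the archimedean variable and `K`-finite, and
`exp(tY) ∈ K` for all `t`, then `Y φ` lies in the (finite-dimensional) span of the right
`K`-translates of `φ`, being the pointwise derivative at `0` of the curve `t ↦ r(exp tY) φ` in that
span (`mem_of_hasDerivAt_apply`, the derivative being `IsArchSmooth.hasDerivAt_flow_zero`).
[cite: Borel1997, 2.16] -/
theorem IsArchSmooth.lieDeriv_mem_kTranslateSpan {φ : G → ℂ} (hφ : IsArchSmooth ι φ)
    (hK : IsKFinite ι φ) {Y : H.lie}
    (hY : ∀ t : ℝ, (H.expMem (t • Y) : GL N A) ∈ H.maximalCompact) :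
    lieDeriv ι Y φ ∈ kTranslateSpan ι φ := by
  haveI : FiniteDimensional ℂ (kTranslateSpan ι φ) := hK
  refine mem_of_hasDerivAt_apply (γ := fun t => archTranslate ι (H.expMem (t • Y)) φ)
    (fun t => ?_) fun g => hφ.hasDerivAt_flow_zero ι Y g
  have hk : H.expMem (t • Y) =
      Subgroup.inclusion H.maximalCompact_le_carrier ⟨(H.expMem (t • Y) : GL N A), hY t⟩ :=
    Subtype.ext rfl
  rw [hk]
  exact archTranslate_mem_kTranslateSpan ι _ φ

variable [FiniteDimensional ℝ A]

/-- Iterated Lie derivatives of smooth functions are smooth, granted the calculus fact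
`isArchSmooth_lieDeriv` of `ArchimedeanCalculus`. Borel–Jacquet 1979, §1.5. [cite: BorelJacquetCorvallis1979, §1.5] -/
theorem IsArchSmooth.iterLieDeriv_of (hs : isArchSmooth_lieDeriv (ι := ι)) (w : List H.lie)
    {φ : G → ℂ} (hφ : IsArchSmooth ι φ) : IsArchSmooth ι (iterLieDeriv ι w φ) := by
  induction w with
  | nil => exact hφ
  | cons X w ih => exact hs X ih

/-- `p φ` is smooth for smooth `φ` and every `p ∈ ℝ⟨𝔤⟩` (a finite linear combination of iterated Lie
derivatives), granted `isArchSmooth_lieDeriv`. Borel–Jacquet 1979, §1.5. [cite: BorelJacquetCorvallis1979, §1.5] -/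
theorem IsArchSmooth.applyFree_of (hs : isArchSmooth_lieDeriv (ι := ι)) (p : FreeAlgebra ℝ H.lie)
    {φ : G → ℂ} (hφ : IsArchSmooth ι φ) : IsArchSmooth ι (applyFree ι p φ) := by
  unfold applyFree
  rw [Finsupp.sum]
  exact (archSmooth ι).sum_mem fun w _ => (archSmooth ι).smul_mem _ (hφ.iterLieDeriv_of hs _)

/-- **`(X · p) φ = X (p φ)`** on smooth `φ`, granted `isArchSmooth_lieDeriv` (both sides are
`ℝ`-linear in `p`, `X` being additive on the smooth functions `w φ`; on the word basis it is the
definition of `iterLieDeriv`). Borel–Jacquet 1979, §1.5–1.6. [cite: BorelJacquetCorvallis1979, §1.5] -/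
theorem applyFree_ι_mul_of (hs : isArchSmooth_lieDeriv (ι := ι)) (X : H.lie)
    (p : FreeAlgebra ℝ H.lie) {φ : G → ℂ} (hφ : IsArchSmooth ι φ) :
    applyFree ι (FreeAlgebra.ι ℝ X * p) φ = lieDeriv ι X (applyFree ι p φ) := by
  let L : FreeAlgebra ℝ H.lie →ₗ[ℝ] (G → ℂ) :=
    { toFun := fun q => applyFree ι (FreeAlgebra.ι ℝ X * q) φ
      map_add' := fun q₁ q₂ => by rw [mul_add, applyFree_add]
      map_smul' := fun c q => by
        rw [mul_smul_comm, applyFree_smul_left, RingHom.id_apply, real_smul_fun_eq_coe_smul] }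
  let R : FreeAlgebra ℝ H.lie →ₗ[ℝ] (G → ℂ) :=
    { toFun := fun q => lieDeriv ι X (applyFree ι q φ)
      map_add' := fun q₁ q₂ => by
        rw [applyFree_add,
          IsArchSmooth.lieDeriv_add ι X (hφ.applyFree_of hs q₁) (hφ.applyFree_of hs q₂)]
      map_smul' := fun c q => by
        rw [applyFree_smul_left, lieDeriv_smul, RingHom.id_apply, real_smul_fun_eq_coe_smul] }
  suffices hLR : L = R from LinearMap.congr_fun hLR p
  refine (FreeAlgebra.basisFreeMonoid ℝ H.lie).ext fun w => ?_
  change applyFree ι (FreeAlgebra.ι ℝ X * FreeAlgebra.basisFreeMonoid ℝ H.lie w) φ =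
    lieDeriv ι X (applyFree ι (FreeAlgebra.basisFreeMonoid ℝ H.lie w) φ)
  have hmul : FreeAlgebra.ι ℝ X * FreeAlgebra.basisFreeMonoid ℝ H.lie w =
      FreeAlgebra.basisFreeMonoid ℝ H.lie (FreeMonoid.of X * w) := by
    rw [basisFreeMonoid_eq_lift, basisFreeMonoid_eq_lift, map_mul, FreeMonoid.lift_eval_of]
  rw [hmul, applyFree_basisFreeMonoid, applyFree_basisFreeMonoid, FreeMonoid.toList_mul,
    FreeMonoid.toList_of]
  rfl

/-- **Central elements commute with Lie derivatives** on smooth `φ`: `z (X φ) = X (z φ)` for a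
central word `z` (`z · X = X · z` in `U(𝔤)`), granted the two calculus facts `isArchSmooth_lieDeriv`
and `applyFree_congr` of `ArchimedeanCalculus`. Borel–Jacquet 1979, §1.6 and 4.3. [cite: BorelJacquetCorvallis1979, §1.6] -/
theorem applyFree_lieDeriv_of_isCentralWord_of (hs : isArchSmooth_lieDeriv (ι := ι))
    (hc : applyFree_congr (ι := ι)) {p : FreeAlgebra ℝ H.lie} (hp : IsCentralWord p) (X : H.lie)
    {φ : G → ℂ} (hφ : IsArchSmooth ι φ) :
    applyFree ι p (lieDeriv ι X φ) = lieDeriv ι X (applyFree ι p φ) := by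
  rw [← applyFree_mul_ι, ← applyFree_ι_mul_of hs X p hφ]
  refine hc ?_ hφ
  rw [map_mul, map_mul, freeToEnveloping_ι]
  exact ((Subalgebra.mem_center_iff.1 hp) _).symm

/-- **Lie derivatives of smooth `Z(𝔤)`-finite functions are `Z(𝔤)`-finite** for any linear real
group, granted the two calculus facts: the `Z(𝔤)`-orbit span of `X φ` lies in the image of the
(finite-dimensional, smooth) `Z(𝔤)`-orbit span of `φ` under the linear map `X`.
Borel–Jacquet 1979, 4.3 (`𝒜` is stable under `𝔤`: `Z(𝔤)`-finiteness of `X φ`); Bump 1997, §3.3.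
[cite: BorelJacquetCorvallis1979, 4.3] -/
theorem isZFinite_lieDeriv_of (hs : isArchSmooth_lieDeriv (ι := ι)) (hc : applyFree_congr (ι := ι))
    {φ : G → ℂ} (hφ : IsArchSmooth ι φ) (hZ : IsZFinite ι φ) (X : H.lie) :
    IsZFinite ι (lieDeriv ι X φ) := by
  set V : Submodule ℂ (G → ℂ) := zOrbitSpan ι φ with hV_def
  haveI : FiniteDimensional ℂ V := hZ
  have hVsmooth : V ≤ archSmooth ι := by
    refine Submodule.span_le.2 ?_
    rintro _ ⟨p, -, rfl⟩
    exact hφ.applyFree_of hs p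
  let Φ : V →ₗ[ℂ] (G → ℂ) :=
    { toFun := fun v => lieDeriv ι X (v : G → ℂ)
      map_add' := fun v₁ v₂ => IsArchSmooth.lieDeriv_add ι X (hVsmooth v₁.2) (hVsmooth v₂.2)
      map_smul' := fun c v => lieDeriv_smul X c (v : G → ℂ) }
  unfold IsZFinite
  refine Submodule.finiteDimensional_of_le (S₂ := LinearMap.range Φ) (Submodule.span_le.2 ?_)
  rintro _ ⟨p, hp, rfl⟩
  rw [SetLike.mem_coe, applyFree_lieDeriv_of_isCentralWord_of hs hc hp X hφ]
  exact ⟨⟨applyFree ι p φ, Submodule.subset_span ⟨p, hp, rfl⟩⟩, rfl⟩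

end ArchCalculus

end Literature.NumberTheory.Automorphic
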